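import Summits.SmoothPoincare4.SmoothPoincare4.Theses.ChargedHalfTurns
import Literature.Topology.FourManifolds.Knots
import Literature.Topology.FourManifolds.ChargedHomotopySphere
import HarnessLib
import HarnessLib.Audit

/-!
# Birth skeleton (BC3) — crux `ChargedHalfTurns.ChargedSphere` (item stmt-SmoothPoincare4-18212)

Route `route-SmoothPoincare4-ChargedHalfTurns` (negative-side route: `closes : ChargedSphere →
InvolutionPSC → ¬ SmoothPoincare4`), crux #3 `ChargedSphere` — the SUPPLY:

  there is a smooth homotopy 4-sphere `M` (Hausdorff, second countable, `C^∞` atlas on `ℝ⁴`,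
  `M ≃ₕ S⁴`) with a smooth involution `ι` whose fixed-point set is the image of a smooth embedding
  `S² → M` (a HALF-TURN), such that NO `ι`-invariant Riemannian metric on `M` has everywhere positive
  scalar curvature.

Standing (item notes 2026-08-17): KNOWN IN PRINT — Kuhrman 2025 Thm. 3 (arXiv:2507.03798, p. 2:
"There exist homotopy 4-spheres with involutions … for which Miyazawa's real Seiberg–Witten invariant
takes all odd positive integer values. These involutions do not preserve any positive scalar curvature
metric"), the involutions being the BRANCHING involutions of the branched double covers
`Σ₂(S⁴, ρK(2,3,|6s+1|))` (homotopy 4-spheres by Thm. 1; proof of Thms. 2–3, p. 11); earlier Miyazawa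
2023 (arXiv:2312.02041) Thm. 4.44 + Thm. 4.32 + proof of Thm. 4.46 for `Σ₂(S⁴, τ⁰ρ¹P(−2,3,7))`,
`|deg| = 3`, with the vanishing "an involution preserving a PSC metric has `|deg| = 1`" (Miyazawa
Prop. 3.14; Baraglia 2026, arXiv:2504.00281, Prop. 1.3(3)). Vendored verbatim as the named fact
`Literature.Topology.FourManifolds.Kuhrman2025_thm3_chargedHomotopySphere` (`Iff.rfl` with the crux;
a named fact is a hypothesis, not a proof). Refuter birth-vetting: survives; `¬InvolutionPSC →
ChargedSphere` and `SmoothPoincare4 → (ChargedSphere ↔ ¬InvolutionPSC)` (evidence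
ChargedSphereProbes.lean). No `Disproof.lean`, no crux workfiles, no landed
`Theorems/ChargedSphere/Negative/*` (`ledger crux ls stmt-SmoothPoincare4-18212`: none, 2026-08-17);
negatives index of the summit: 0 refuted statements.

## The line `birth` — NATIVE FORM + FIXED-LOCUS BRIDGE

Every charged half-turn in print is the branching (deck) involution of a 2-FOLD CYCLIC BRANCHED COVER
`q : M = Σ₂(S⁴, K) → S⁴` of the standard 4-sphere along a 2-KNOT `K : S² ↪ S⁴`
(`Literature.Topology.FourManifolds.TwoKnot`), and the printed proofs live entirely in that category
(Kuhrman §2.2: mapping-torus decomposition of `Σ₂(S⁴, τ^m ρ^n K)`; Miyazawa §4: the real Seiberg–Witten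
degree is an invariant OF THE 2-KNOT, `|deg(ρK)| = |deg(K)|`). The crux, by contrast, is stated
intrinsically on the pair `(M, ι)` ("Fix ι is an embedded 2-sphere"), which is what `closes` transports
along a putative diffeomorphism `M ≅ S⁴`. The skeleton separates the two:

* `stub_chargedBranchedCover` — **THE SUPPLY IN ITS NATIVE FORM (known in print; XL+ to formalise):**
  there are a 2-knot `K` and a smooth 2-fold cyclic branched cover `(M, ι, q)` of `S⁴` along `K` —
  `ι : M → M` a smooth involution, `q : M → S⁴` smooth and `ι`-invariant with fibres EXACTLY the
  `ι`-orbits, a local diffeomorphism off `Fix ι`, and at each fixed point an `ι`-ADAPTED FOLD CHART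
  (`ι` is the linear half-turn `(x₀,x₁,x₂,x₃) ↦ (x₀,x₁,−x₂,−x₃)` and `q` is the squaring map
  `(x₀,x₁,z) ↦ (x₀,x₁,z²)`, `z = x₂ + i x₃`, in charts), with branch locus `q(Fix ι) = K(S²)` — such that
  `M` is a homotopy 4-sphere and NO `ι`-invariant Riemannian metric on `M` has positive scalar
  curvature. In print: `K = ρK(2,3,|6s+1|)`, `s ∉ {0, −1}` (Kuhrman Thms. 1, 3) or `K = τ⁰ρ¹P(−2,3,7)`
  (Miyazawa Thms. 4.32, 4.44, 4.46). NOT the crux: it never mentions an embedded fixed sphere, and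
  conversely a half-turn `(M, ι)` of a homotopy sphere is a branched double cover of the orbifold
  quotient `M/ι`, a homotopy 4-sphere of UNKNOWN diffeotype, not of `S⁴` — the stub pins the quotient
  to be standard (strictly more than the crux asks). Why it might fail: exactly the crux's risk
  (preprint dependence: Miyazawa Thm. 4.32/4.44, Kuhrman Thm. 1; the vanishing needs the Real spin
  structure to be ODD), plus the typing risk that the inline fold-chart predicate is not satisfied by
  the smooth structure the authors use (it is: the smooth structure on a cyclic branched cover is
  DEFINED by such equivariant charts, Zeeman 1965 §6 / Pao 1978 / Plotnick 1984 §5; the same local model,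
  read downstairs, is inlined in route QuotientSpheres' `InvolutionQuotient`).
* `stub_fixedTwoSphere` — **THE FIXED-LOCUS BRIDGE (structural; true; M–L to formalise):** for EVERY
  smooth 2-fold cyclic branched cover `(M, ι, q)` of `S⁴` along a 2-knot `K` (same clauses; no
  homotopy-sphere and no metric hypothesis) the fixed-point set of `ι` is the image of a smooth
  embedding `e : S² → M` — namely `e = (q|Fix ι)⁻¹ ∘ K`, the LIFT of the branch knot. Proof in print
  (folklore; Kuhrman §2 "the fixed point set … the lifted 2-knot"; Zeeman 1965 §6; Giffen 1966 / Gordon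
  1974 for its knottedness): `q|Fix ι` is injective (a fibre through a fixed point is a singleton) onto
  `q(Fix ι) = K(S²)`; in an adapted fold chart `Fix ι ∩ U = φ⁻¹{x₂ = x₃ = 0}` (as `φ` is injective on the
  `ι`-invariant `U` and `φ ∘ ι = R ∘ φ`), on which `ψ ∘ q = fold ∘ φ` is the identity of the plane, so
  locally `e = φ⁻¹ ∘ J ∘ P ∘ ψ ∘ K` (`P` the projection to `(x₀,x₁)`, `J` the inclusion of the plane):
  `C^∞`, immersive (`ψ ∘ K` is an immersion with image in the plane near `ψ(q x₀)`, because points of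
  `fold(φ U)` off the plane have NON-fixed preimages), injective, and a topological embedding since
  `q ∘ e = K` is one. NOT the crux and not the summit: a `∀`-lemma about branched covers, no existence.
* `chargedSphere_of_stubs` — the composition with explicit hypotheses (pure logic, sorry-free): the
  native supply gives `(K, M, M ≃ₕ S⁴, ι, q)`; the bridge gives `e` with `Fix ι = e(S²)`; forget `q, K`.
  Its conclusion is the crux body UNFOLDED, so that exactly ONE theorem of this file concludes the
  crux by name:
* `ChargedSphere_of : ChargedSphere` — THE SKELETON THEOREM (crux BY NAME from the two declared
  stubs, the only `sorry`s of the file), and the BC3 letter `stub₁-sig → stub₂-sig → ChargedSphere`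
  as an `example`.

Hardest stub: `stub_chargedBranchedCover` (it carries the whole gauge-theoretic certificate: real
Seiberg–Witten degree `≠ ±1` of the pair, Miyazawa Thm. 4.32 / Kang–Park–Taniguchi, and the PSC
vanishing Prop. 3.14 — realistic Lean output is a cited Literature fact chain down to the 2-knot, not a
formalisation of Real Seiberg–Witten theory; plus simple connectivity of `Σ₂`, Kuhrman Thm. 1 /
Miyazawa Thm. 4.44, and the smooth branched-cover construction itself). What the split buys: the
supply is restated where its proof and its computability live (2-knots in the standard `S⁴`: the
degree is a 2-knot invariant, the kill statements `KuhrmanSphereStandard` / `OddTwistDegreeOne` of the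
route are about the same covers), while the intrinsic half-turn form needed by `closes` is recovered by
a separate, provable geometric lemma.

Disproof used: none exists for this crux (no `Disproof.lean`; no `_false_without_` theorems; no landed
Negative lemma) — nothing to honour or avoid. Negatives index (`ledger negatives --problem
SmoothPoincare4`, 2026-08-17): 0 refuted statements; neither stub is an instance of a refuted statement.

BC3 probes (planner folder `bc/probe_stub{1,2}_{crux,summit,negsummit}.lean`, `bc/probe_stub{1,2}_
destructured.lean`, `bc/probe_aesop_goalonly.lean`; farm `lean check`, 2026-08-17): for each stub and each
target `ChargedSphere` (crux), `SmoothPoincare4` (summit), `¬ SmoothPoincare4` (the route's conclusion),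
EVERY tactic of the battery `exact? | simpa | simpa [C] | (unfold C; simpa) | aesop | (unfold C; aesop)` —
run one tactic per `example` with its own 400k heartbeats, because a heartbeat timeout inside `first | …`
skips the remaining alternatives — FAILS: `exact?` and `intro h; exact?` "could not close the goal" (all
6 stub/target pairs); `simpa`, `simpa [C]`, `aesop` exhaust 400k heartbeats normalising the stub
hypothesis. With the hypothesis introduced and destructured first (so the search is on the target):
`unfold C; exact?` could not close the goal (6/6); `aesop (config := { useSimpAll := false })` (1M
heartbeats) ends "failed to prove the goal after exhaustive search" on `stub₁ → SmoothPoincare4`,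
`stub₁ → ¬SmoothPoincare4`, `stub₂ → SmoothPoincare4`, `stub₂ → ¬SmoothPoincare4` (residual goals
`NonemptyDiffeomorphSphere M 4` resp. `∃ M …, ¬ NonemptyDiffeomorphSphere M 4`) and times out at `whnf` on
`stubᵢ → ChargedSphere`; handing aesop the witnesses `⟨M, ‹instances›, M ≃ₕ S⁴, ι, ?_⟩` of `stub₁` leaves
exactly `⊢ ∃ e, Manifold.IsSmoothEmbedding (𝓡 2) (𝓡 4) ∞ e ∧ ∀ x, ι x = x ↔ x ∈ Set.range e` — the content
of `stub_fixedTwoSphere`. 56 probe examples, 0 closed: no stub is cheaply the crux, the summit or its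
negation.
-/

noncomputable section

open scoped Manifold ContDiff Topology ContinuousMap
open Summit.SmoothPoincare4.SmoothPoincare4.Theses.ChargedHalfTurns (ChargedSphere)

-- `Summit.<Summit>.<Problem>`: for the single-conjunct summit the duplicate segment is mandated.
set_option linter.dupNamespace false
set_option linter.unusedVariables false

namespace Summit.SmoothPoincare4.SmoothPoincare4.Cruxes.ChargedSphere.Birth

/-! ## The two registered stubs (`sorry` lives ONLY here; signatures over tree declarations)

Inline vocabulary. `S⁴ := Metric.sphere (0 : EuclideanSpace ℝ (Fin 5)) 1`, `S² := Metric.sphere (0 :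
EuclideanSpace ℝ (Fin 3)) 1` (Mathlib manifold structures, models `𝓡 4`, `𝓡 2`); `K :
Literature.Topology.FourManifolds.TwoKnot` (a smooth embedding `S² ↪ S⁴`). The BRANCHED DOUBLE COVER
DATUM `(M, ι, q)` OF `S⁴` ALONG `K` is the conjunction: `ι` smooth, `ι ∘ ι = id`; `q` smooth,
`q ∘ ι = q`, `q x = q y → y = x ∨ y = ι x`, `q` surjective; `q` a local diffeomorphism at every
non-fixed point; at every fixed point `x` an `ι`-invariant open `U ∋ x` with an injective local
diffeomorphism `φ : U → ℝ⁴` and an open `V ⊇ q(U)` with an injective local diffeomorphism `ψ : V → ℝ⁴`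
such that `φ (ι y) = R (φ y)`, `R (x₀,x₁,x₂,x₃) = (x₀,x₁,−x₂,−x₃)`, and `ψ (q y) = fold (φ y)`,
`fold (x₀,x₁,x₂,x₃) = (x₀, x₁, Re (x₂ + i x₃)², Im (x₂ + i x₃)²)`, for `y ∈ U`; and the branch locus
`q '' Fix ι = range K`. -/

/-- **STUB 1 `stub_chargedBranchedCover` — CHARGED BRANCHED DOUBLE COVERS OF `S⁴` EXIST (the supply in
its native form; known in print, registered open).** There are a 2-knot `K : S² ↪ S⁴` and a smooth 2-fold
cyclic branched cover `(M, ι, q)` of `S⁴` along `K` (the datum above: `M` a Hausdorff second-countable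
`C^∞` 4-manifold on `ℝ⁴`, `ι` its branching involution with adapted fold charts, branch locus `K(S²)`)
such that `M` is homotopy equivalent to `S⁴` and no `ι`-invariant `C^∞` Riemannian metric on `M` (with
Levi-Civita connection) has everywhere positive scalar curvature. In print: `K = ρK(2,3,|6s+1|)`,
`s ∉ {0,−1}` — `Σ₂(S⁴, K)` is a homotopy 4-sphere (Kuhrman 2025 Thm. 1) and its branching involution
has real Seiberg–Witten degree `4j ± 1 ≠ ±1` (Kuhrman §4 with Kang–Park–Taniguchi), whence no invariant
PSC metric (Kuhrman Thm. 3 and proof p. 11; Miyazawa 2023 Prop. 3.14 / proof of Thm. 4.46; Baraglia 2026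
Prop. 1.3(3)); likewise `K = τ⁰ρ¹P(−2,3,7)`, `|deg| = 3` (Miyazawa Thms. 4.32, 4.44, 4.46). Not the
crux (no embedded fixed sphere is asserted; conversely the crux does not make the quotient `M/ι`
standard). Size: XL+ (vendored-fact chain realistic). [cite: Kuhrman2025, Thm. 1, Thm. 3, §2.2]
[cite: Miyazawa2023, Thm. 4.32, Thm. 4.44, Thm. 4.46, Prop. 3.14] [cite: Baraglia2026, Prop. 1.3(3)] -/
theorem stub_chargedBranchedCover :
    ∃ (K : Literature.Topology.FourManifolds.TwoKnot) (M : Type) (_ : TopologicalSpace M) (_ : T2Space M)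
      (_ : SecondCountableTopology M) (_ : ChartedSpace (EuclideanSpace ℝ (Fin 4)) M)
      (_ : IsManifold (𝓡 4) ((⊤ : ℕ∞) : WithTop ℕ∞) M) (_ : M ≃ₕ Metric.sphere (0 : EuclideanSpace ℝ (Fin 5)) 1)
      (ι : M → M) (q : M → Metric.sphere (0 : EuclideanSpace ℝ (Fin 5)) 1),
      (ContMDiff (𝓡 4) (𝓡 4) ((⊤ : ℕ∞) : WithTop ℕ∞) ι ∧ ι ∘ ι = id ∧
        ContMDiff (𝓡 4) (𝓡 4) ((⊤ : ℕ∞) : WithTop ℕ∞) q ∧ (∀ x, q (ι x) = q x) ∧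
        (∀ x y, q x = q y → y = x ∨ y = ι x) ∧ Function.Surjective q ∧
        (∀ x, ι x ≠ x → IsLocalDiffeomorphAt (𝓡 4) (𝓡 4) ((⊤ : ℕ∞) : WithTop ℕ∞) q x) ∧
        (∀ x, ι x = x → ∃ (U : Set M) (φ : M → EuclideanSpace ℝ (Fin 4)) (V : Set (Metric.sphere (0 : EuclideanSpace ℝ (Fin 5)) 1))
            (ψ : Metric.sphere (0 : EuclideanSpace ℝ (Fin 5)) 1 → EuclideanSpace ℝ (Fin 4)),
          IsOpen U ∧ x ∈ U ∧ (∀ y ∈ U, ι y ∈ U) ∧ Set.InjOn φ U ∧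
          (∀ y ∈ U, IsLocalDiffeomorphAt (𝓡 4) (𝓡 4) ((⊤ : ℕ∞) : WithTop ℕ∞) φ y) ∧
          IsOpen V ∧ q '' U ⊆ V ∧ Set.InjOn ψ V ∧ (∀ z ∈ V, IsLocalDiffeomorphAt (𝓡 4) (𝓡 4) ((⊤ : ℕ∞) : WithTop ℕ∞) ψ z) ∧
          (∀ y ∈ U, φ (ι y) = WithLp.toLp 2 (fun j : Fin 4 => if j = 2 ∨ j = 3 then -(φ y j) else φ y j)) ∧
          ∀ y ∈ U, ψ (q y) = WithLp.toLp 2 (fun j : Fin 4 =>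
            if j = 2 then ((((φ y 2 : ℝ) : ℂ) + ((φ y 3 : ℝ) : ℂ) * Complex.I) ^ 2).re
            else if j = 3 then ((((φ y 2 : ℝ) : ℂ) + ((φ y 3 : ℝ) : ℂ) * Complex.I) ^ 2).im else φ y j)) ∧
        q '' {x | ι x = x} = Set.range ⇑K) ∧
      ∀ (g : Literature.Geometry.Lorentzian.PseudoRiemannianMetric (𝓡 4) ((⊤ : ℕ∞) : WithTop ℕ∞) (EuclideanSpace ℝ (Fin 4))
          (TangentSpace (𝓡 4) : M → Type _)) (_ : g.HasLeviCivita),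
        g.IsRiemannian → (∀ x, 0 < g.scalarCurvature x) →
          ¬ (∀ y, Literature.Geometry.Lorentzian.pullbackBilin (I := 𝓡 4) (I' := 𝓡 4) ι g.val y = g.val y) := by
  sorry

/-- **STUB 2 `stub_fixedTwoSphere` — THE FIXED LOCUS OF A BRANCHED DOUBLE COVER OF `S⁴` ALONG A 2-KNOT IS
AN EMBEDDED 2-SPHERE (structural bridge; true; registered open).** For every smooth 2-fold cyclic
branched cover `(M, ι, q)` of `S⁴` along a 2-knot `K` (the datum above — no homotopy-sphere, compactness
or metric hypothesis), `Fix ι` is the image of a smooth embedding `e : S² → M`: `e = (q|Fix ι)⁻¹ ∘ K`,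
the lift of the branch knot. `q|Fix ι` is injective onto `q(Fix ι) = K(S²)`; in an adapted fold chart
`Fix ι ∩ U = φ⁻¹{x₂ = x₃ = 0}` and `ψ ∘ q = fold ∘ φ` restricts to the identity of that plane, so locally
`e = φ⁻¹ ∘ J ∘ P ∘ ψ ∘ K` is `C^∞` and immersive, and `e` is a topological embedding because `q ∘ e = K`
is. Not the crux, not the summit (a `∀`-lemma, no existence). Size: M–L (Mathlib: `IsImmersion` via
charts, `IsLocalDiffeomorphAt`, `Topology.IsEmbedding`). [cite: Kuhrman2025, §2.2]
[cite: Zeeman1965, §6] [folklore] -/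
theorem stub_fixedTwoSphere :
    ∀ (M : Type) [TopologicalSpace M] [T2Space M] [SecondCountableTopology M]
      [ChartedSpace (EuclideanSpace ℝ (Fin 4)) M] [IsManifold (𝓡 4) ((⊤ : ℕ∞) : WithTop ℕ∞) M]
      (ι : M → M) (q : M → Metric.sphere (0 : EuclideanSpace ℝ (Fin 5)) 1) (K : Literature.Topology.FourManifolds.TwoKnot),
      ContMDiff (𝓡 4) (𝓡 4) ((⊤ : ℕ∞) : WithTop ℕ∞) ι → ι ∘ ι = id →
      ContMDiff (𝓡 4) (𝓡 4) ((⊤ : ℕ∞) : WithTop ℕ∞) q → (∀ x, q (ι x) = q x) →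
      (∀ x y, q x = q y → y = x ∨ y = ι x) → Function.Surjective q →
      (∀ x, ι x ≠ x → IsLocalDiffeomorphAt (𝓡 4) (𝓡 4) ((⊤ : ℕ∞) : WithTop ℕ∞) q x) →
      (∀ x, ι x = x → ∃ (U : Set M) (φ : M → EuclideanSpace ℝ (Fin 4)) (V : Set (Metric.sphere (0 : EuclideanSpace ℝ (Fin 5)) 1))
          (ψ : Metric.sphere (0 : EuclideanSpace ℝ (Fin 5)) 1 → EuclideanSpace ℝ (Fin 4)),
        IsOpen U ∧ x ∈ U ∧ (∀ y ∈ U, ι y ∈ U) ∧ Set.InjOn φ U ∧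
        (∀ y ∈ U, IsLocalDiffeomorphAt (𝓡 4) (𝓡 4) ((⊤ : ℕ∞) : WithTop ℕ∞) φ y) ∧
        IsOpen V ∧ q '' U ⊆ V ∧ Set.InjOn ψ V ∧ (∀ z ∈ V, IsLocalDiffeomorphAt (𝓡 4) (𝓡 4) ((⊤ : ℕ∞) : WithTop ℕ∞) ψ z) ∧
        (∀ y ∈ U, φ (ι y) = WithLp.toLp 2 (fun j : Fin 4 => if j = 2 ∨ j = 3 then -(φ y j) else φ y j)) ∧
        ∀ y ∈ U, ψ (q y) = WithLp.toLp 2 (fun j : Fin 4 =>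
          if j = 2 then ((((φ y 2 : ℝ) : ℂ) + ((φ y 3 : ℝ) : ℂ) * Complex.I) ^ 2).re
          else if j = 3 then ((((φ y 2 : ℝ) : ℂ) + ((φ y 3 : ℝ) : ℂ) * Complex.I) ^ 2).im else φ y j)) →
      q '' {x | ι x = x} = Set.range ⇑K →
      ∃ e : Metric.sphere (0 : EuclideanSpace ℝ (Fin 3)) 1 → M,
        Manifold.IsSmoothEmbedding (𝓡 2) (𝓡 4) ((⊤ : ℕ∞) : WithTop ℕ∞) e ∧ ∀ x, ι x = x ↔ x ∈ Set.range e := by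
  sorry

/-! ## Composition: stubs ⟹ crux (no `sorry` below this line) -/

/-- **`chargedSphere_of_stubs` — arrow form with explicit hypotheses** (`stub₁-sig → stub₂-sig → ⟨crux
body⟩`, the conclusion UNFOLDED so that `ChargedSphere_of` below is the only theorem of this file
concluding the crux by name): the native supply gives `(K, M, M ≃ₕ S⁴, ι, q)` with no invariant PSC
metric, the fixed-locus bridge applied to `(M, ι, q, K)` gives the embedded fixed 2-sphere `e`;
forget `q` and `K`. Pure logic. [folklore] -/
theorem chargedSphere_of_stubs
    (h₁ : ∃ (K : Literature.Topology.FourManifolds.TwoKnot) (M : Type) (_ : TopologicalSpace M) (_ : T2Space M)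
        (_ : SecondCountableTopology M) (_ : ChartedSpace (EuclideanSpace ℝ (Fin 4)) M)
        (_ : IsManifold (𝓡 4) ((⊤ : ℕ∞) : WithTop ℕ∞) M) (_ : M ≃ₕ Metric.sphere (0 : EuclideanSpace ℝ (Fin 5)) 1)
        (ι : M → M) (q : M → Metric.sphere (0 : EuclideanSpace ℝ (Fin 5)) 1),
        (ContMDiff (𝓡 4) (𝓡 4) ((⊤ : ℕ∞) : WithTop ℕ∞) ι ∧ ι ∘ ι = id ∧
          ContMDiff (𝓡 4) (𝓡 4) ((⊤ : ℕ∞) : WithTop ℕ∞) q ∧ (∀ x, q (ι x) = q x) ∧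
          (∀ x y, q x = q y → y = x ∨ y = ι x) ∧ Function.Surjective q ∧
          (∀ x, ι x ≠ x → IsLocalDiffeomorphAt (𝓡 4) (𝓡 4) ((⊤ : ℕ∞) : WithTop ℕ∞) q x) ∧
          (∀ x, ι x = x → ∃ (U : Set M) (φ : M → EuclideanSpace ℝ (Fin 4)) (V : Set (Metric.sphere (0 : EuclideanSpace ℝ (Fin 5)) 1))
              (ψ : Metric.sphere (0 : EuclideanSpace ℝ (Fin 5)) 1 → EuclideanSpace ℝ (Fin 4)),
            IsOpen U ∧ x ∈ U ∧ (∀ y ∈ U, ι y ∈ U) ∧ Set.InjOn φ U ∧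
            (∀ y ∈ U, IsLocalDiffeomorphAt (𝓡 4) (𝓡 4) ((⊤ : ℕ∞) : WithTop ℕ∞) φ y) ∧
            IsOpen V ∧ q '' U ⊆ V ∧ Set.InjOn ψ V ∧ (∀ z ∈ V, IsLocalDiffeomorphAt (𝓡 4) (𝓡 4) ((⊤ : ℕ∞) : WithTop ℕ∞) ψ z) ∧
            (∀ y ∈ U, φ (ι y) = WithLp.toLp 2 (fun j : Fin 4 => if j = 2 ∨ j = 3 then -(φ y j) else φ y j)) ∧
            ∀ y ∈ U, ψ (q y) = WithLp.toLp 2 (fun j : Fin 4 =>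
              if j = 2 then ((((φ y 2 : ℝ) : ℂ) + ((φ y 3 : ℝ) : ℂ) * Complex.I) ^ 2).re
              else if j = 3 then ((((φ y 2 : ℝ) : ℂ) + ((φ y 3 : ℝ) : ℂ) * Complex.I) ^ 2).im else φ y j)) ∧
          q '' {x | ι x = x} = Set.range ⇑K) ∧
        ∀ (g : Literature.Geometry.Lorentzian.PseudoRiemannianMetric (𝓡 4) ((⊤ : ℕ∞) : WithTop ℕ∞) (EuclideanSpace ℝ (Fin 4))
            (TangentSpace (𝓡 4) : M → Type _)) (_ : g.HasLeviCivita),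
          g.IsRiemannian → (∀ x, 0 < g.scalarCurvature x) →
            ¬ (∀ y, Literature.Geometry.Lorentzian.pullbackBilin (I := 𝓡 4) (I' := 𝓡 4) ι g.val y = g.val y))
    (h₂ : ∀ (M : Type) [TopologicalSpace M] [T2Space M] [SecondCountableTopology M]
        [ChartedSpace (EuclideanSpace ℝ (Fin 4)) M] [IsManifold (𝓡 4) ((⊤ : ℕ∞) : WithTop ℕ∞) M]
        (ι : M → M) (q : M → Metric.sphere (0 : EuclideanSpace ℝ (Fin 5)) 1) (K : Literature.Topology.FourManifolds.TwoKnot),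
        ContMDiff (𝓡 4) (𝓡 4) ((⊤ : ℕ∞) : WithTop ℕ∞) ι → ι ∘ ι = id →
        ContMDiff (𝓡 4) (𝓡 4) ((⊤ : ℕ∞) : WithTop ℕ∞) q → (∀ x, q (ι x) = q x) →
        (∀ x y, q x = q y → y = x ∨ y = ι x) → Function.Surjective q →
        (∀ x, ι x ≠ x → IsLocalDiffeomorphAt (𝓡 4) (𝓡 4) ((⊤ : ℕ∞) : WithTop ℕ∞) q x) →
        (∀ x, ι x = x → ∃ (U : Set M) (φ : M → EuclideanSpace ℝ (Fin 4)) (V : Set (Metric.sphere (0 : EuclideanSpace ℝ (Fin 5)) 1))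
            (ψ : Metric.sphere (0 : EuclideanSpace ℝ (Fin 5)) 1 → EuclideanSpace ℝ (Fin 4)),
          IsOpen U ∧ x ∈ U ∧ (∀ y ∈ U, ι y ∈ U) ∧ Set.InjOn φ U ∧
          (∀ y ∈ U, IsLocalDiffeomorphAt (𝓡 4) (𝓡 4) ((⊤ : ℕ∞) : WithTop ℕ∞) φ y) ∧
          IsOpen V ∧ q '' U ⊆ V ∧ Set.InjOn ψ V ∧ (∀ z ∈ V, IsLocalDiffeomorphAt (𝓡 4) (𝓡 4) ((⊤ : ℕ∞) : WithTop ℕ∞) ψ z) ∧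
          (∀ y ∈ U, φ (ι y) = WithLp.toLp 2 (fun j : Fin 4 => if j = 2 ∨ j = 3 then -(φ y j) else φ y j)) ∧
          ∀ y ∈ U, ψ (q y) = WithLp.toLp 2 (fun j : Fin 4 =>
            if j = 2 then ((((φ y 2 : ℝ) : ℂ) + ((φ y 3 : ℝ) : ℂ) * Complex.I) ^ 2).re
            else if j = 3 then ((((φ y 2 : ℝ) : ℂ) + ((φ y 3 : ℝ) : ℂ) * Complex.I) ^ 2).im else φ y j)) →
        q '' {x | ι x = x} = Set.range ⇑K →
        ∃ e : Metric.sphere (0 : EuclideanSpace ℝ (Fin 3)) 1 → M,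
          Manifold.IsSmoothEmbedding (𝓡 2) (𝓡 4) ((⊤ : ℕ∞) : WithTop ℕ∞) e ∧ ∀ x, ι x = x ↔ x ∈ Set.range e) :
    ∃ (M : Type) (_ : TopologicalSpace M) (_ : T2Space M) (_ : SecondCountableTopology M)
      (_ : ChartedSpace (EuclideanSpace ℝ (Fin 4)) M) (_ : IsManifold (𝓡 4) ((⊤ : ℕ∞) : WithTop ℕ∞) M)
      (_ : M ≃ₕ Metric.sphere (0 : EuclideanSpace ℝ (Fin 5)) 1) (ι : M → M) (e : Metric.sphere (0 : EuclideanSpace ℝ (Fin 3)) 1 → M),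
      ContMDiff (𝓡 4) (𝓡 4) ((⊤ : ℕ∞) : WithTop ℕ∞) ι ∧ ι ∘ ι = id ∧
      Manifold.IsSmoothEmbedding (𝓡 2) (𝓡 4) ((⊤ : ℕ∞) : WithTop ℕ∞) e ∧ (∀ x, ι x = x ↔ x ∈ Set.range e) ∧
      ∀ (g : Literature.Geometry.Lorentzian.PseudoRiemannianMetric (𝓡 4) ((⊤ : ℕ∞) : WithTop ℕ∞) (EuclideanSpace ℝ (Fin 4))
          (TangentSpace (𝓡 4) : M → Type _)) (_ : g.HasLeviCivita),
        g.IsRiemannian → (∀ x, 0 < g.scalarCurvature x) →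
          ¬ (∀ y, Literature.Geometry.Lorentzian.pullbackBilin (I := 𝓡 4) (I' := 𝓡 4) ι g.val y = g.val y) := by
  obtain ⟨K, M, _, _, _, _, _, e₄, ι, q, ⟨hι, hinv, hq, hqι, hfib, hsurj, hloc, hfold, hbr⟩, hno⟩ := h₁
  obtain ⟨e, he, hfix⟩ := h₂ M ι q K hι hinv hq hqι hfib hsurj hloc hfold hbr
  exact ⟨M, ‹_›, ‹_›, ‹_›, ‹_›, ‹_›, e₄, ι, e, hι, hinv, he, hfix, hno⟩

/-- **`ChargedSphere_of` — THE SKELETON THEOREM**: the crux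
`Summit.SmoothPoincare4.SmoothPoincare4.Theses.ChargedHalfTurns.ChargedSphere` BY NAME, closed modulo the
two registered stubs `stub_chargedBranchedCover`, `stub_fixedTwoSphere` (the only `sorry`s of this file)
through the sorry-free composition `chargedSphere_of_stubs`. Becomes the crux proof when both stubs are
discharged. [folklore] -/
theorem ChargedSphere_of : ChargedSphere :=
  chargedSphere_of_stubs stub_chargedBranchedCover stub_fixedTwoSphere

/-- BC3 letter: `⟨stub₁-sig⟩ → ⟨stub₂-sig⟩ → ChargedSphere` with the crux BY NAME (an `example`, so that
`ChargedSphere_of` stays the only by-name candidate the skeleton audit sees). [folklore] -/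
example :
    (∃ (K : Literature.Topology.FourManifolds.TwoKnot) (M : Type) (_ : TopologicalSpace M) (_ : T2Space M)
        (_ : SecondCountableTopology M) (_ : ChartedSpace (EuclideanSpace ℝ (Fin 4)) M)
        (_ : IsManifold (𝓡 4) ((⊤ : ℕ∞) : WithTop ℕ∞) M) (_ : M ≃ₕ Metric.sphere (0 : EuclideanSpace ℝ (Fin 5)) 1)
        (ι : M → M) (q : M → Metric.sphere (0 : EuclideanSpace ℝ (Fin 5)) 1),
        (ContMDiff (𝓡 4) (𝓡 4) ((⊤ : ℕ∞) : WithTop ℕ∞) ι ∧ ι ∘ ι = id ∧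
          ContMDiff (𝓡 4) (𝓡 4) ((⊤ : ℕ∞) : WithTop ℕ∞) q ∧ (∀ x, q (ι x) = q x) ∧
          (∀ x y, q x = q y → y = x ∨ y = ι x) ∧ Function.Surjective q ∧
          (∀ x, ι x ≠ x → IsLocalDiffeomorphAt (𝓡 4) (𝓡 4) ((⊤ : ℕ∞) : WithTop ℕ∞) q x) ∧
          (∀ x, ι x = x → ∃ (U : Set M) (φ : M → EuclideanSpace ℝ (Fin 4)) (V : Set (Metric.sphere (0 : EuclideanSpace ℝ (Fin 5)) 1))
              (ψ : Metric.sphere (0 : EuclideanSpace ℝ (Fin 5)) 1 → EuclideanSpace ℝ (Fin 4)),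
            IsOpen U ∧ x ∈ U ∧ (∀ y ∈ U, ι y ∈ U) ∧ Set.InjOn φ U ∧
            (∀ y ∈ U, IsLocalDiffeomorphAt (𝓡 4) (𝓡 4) ((⊤ : ℕ∞) : WithTop ℕ∞) φ y) ∧
            IsOpen V ∧ q '' U ⊆ V ∧ Set.InjOn ψ V ∧ (∀ z ∈ V, IsLocalDiffeomorphAt (𝓡 4) (𝓡 4) ((⊤ : ℕ∞) : WithTop ℕ∞) ψ z) ∧
            (∀ y ∈ U, φ (ι y) = WithLp.toLp 2 (fun j : Fin 4 => if j = 2 ∨ j = 3 then -(φ y j) else φ y j)) ∧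
            ∀ y ∈ U, ψ (q y) = WithLp.toLp 2 (fun j : Fin 4 =>
              if j = 2 then ((((φ y 2 : ℝ) : ℂ) + ((φ y 3 : ℝ) : ℂ) * Complex.I) ^ 2).re
              else if j = 3 then ((((φ y 2 : ℝ) : ℂ) + ((φ y 3 : ℝ) : ℂ) * Complex.I) ^ 2).im else φ y j)) ∧
          q '' {x | ι x = x} = Set.range ⇑K) ∧
        ∀ (g : Literature.Geometry.Lorentzian.PseudoRiemannianMetric (𝓡 4) ((⊤ : ℕ∞) : WithTop ℕ∞) (EuclideanSpace ℝ (Fin 4))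
            (TangentSpace (𝓡 4) : M → Type _)) (_ : g.HasLeviCivita),
          g.IsRiemannian → (∀ x, 0 < g.scalarCurvature x) →
            ¬ (∀ y, Literature.Geometry.Lorentzian.pullbackBilin (I := 𝓡 4) (I' := 𝓡 4) ι g.val y = g.val y)) →
    (∀ (M : Type) [TopologicalSpace M] [T2Space M] [SecondCountableTopology M]
        [ChartedSpace (EuclideanSpace ℝ (Fin 4)) M] [IsManifold (𝓡 4) ((⊤ : ℕ∞) : WithTop ℕ∞) M]
        (ι : M → M) (q : M → Metric.sphere (0 : EuclideanSpace ℝ (Fin 5)) 1) (K : Literature.Topology.FourManifolds.TwoKnot),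
        ContMDiff (𝓡 4) (𝓡 4) ((⊤ : ℕ∞) : WithTop ℕ∞) ι → ι ∘ ι = id →
        ContMDiff (𝓡 4) (𝓡 4) ((⊤ : ℕ∞) : WithTop ℕ∞) q → (∀ x, q (ι x) = q x) →
        (∀ x y, q x = q y → y = x ∨ y = ι x) → Function.Surjective q →
        (∀ x, ι x ≠ x → IsLocalDiffeomorphAt (𝓡 4) (𝓡 4) ((⊤ : ℕ∞) : WithTop ℕ∞) q x) →
        (∀ x, ι x = x → ∃ (U : Set M) (φ : M → EuclideanSpace ℝ (Fin 4)) (V : Set (Metric.sphere (0 : EuclideanSpace ℝ (Fin 5)) 1))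
            (ψ : Metric.sphere (0 : EuclideanSpace ℝ (Fin 5)) 1 → EuclideanSpace ℝ (Fin 4)),
          IsOpen U ∧ x ∈ U ∧ (∀ y ∈ U, ι y ∈ U) ∧ Set.InjOn φ U ∧
          (∀ y ∈ U, IsLocalDiffeomorphAt (𝓡 4) (𝓡 4) ((⊤ : ℕ∞) : WithTop ℕ∞) φ y) ∧
          IsOpen V ∧ q '' U ⊆ V ∧ Set.InjOn ψ V ∧ (∀ z ∈ V, IsLocalDiffeomorphAt (𝓡 4) (𝓡 4) ((⊤ : ℕ∞) : WithTop ℕ∞) ψ z) ∧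
          (∀ y ∈ U, φ (ι y) = WithLp.toLp 2 (fun j : Fin 4 => if j = 2 ∨ j = 3 then -(φ y j) else φ y j)) ∧
          ∀ y ∈ U, ψ (q y) = WithLp.toLp 2 (fun j : Fin 4 =>
            if j = 2 then ((((φ y 2 : ℝ) : ℂ) + ((φ y 3 : ℝ) : ℂ) * Complex.I) ^ 2).re
            else if j = 3 then ((((φ y 2 : ℝ) : ℂ) + ((φ y 3 : ℝ) : ℂ) * Complex.I) ^ 2).im else φ y j)) →
        q '' {x | ι x = x} = Set.range ⇑K →
        ∃ e : Metric.sphere (0 : EuclideanSpace ℝ (Fin 3)) 1 → M,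
          Manifold.IsSmoothEmbedding (𝓡 2) (𝓡 4) ((⊤ : ℕ∞) : WithTop ℕ∞) e ∧ ∀ x, ι x = x ↔ x ∈ Set.range e) →
    ChargedSphere :=
  chargedSphere_of_stubs

/-- Record (grounder g78-6 / refuter rattack-18212): the crux IS, verbatim, the vendored named fact
`Literature.Topology.FourManifolds.Kuhrman2025_thm3_chargedHomotopySphere` (a `Prop`, usable only as a
hypothesis). [cite: Kuhrman2025, Thm. 3] -/
example : Literature.Topology.FourManifolds.Kuhrman2025_thm3_chargedHomotopySphere ↔ ChargedSphere :=
  Iff.rfl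

end Summit.SmoothPoincare4.SmoothPoincare4.Cruxes.ChargedSphere.Birth

end
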